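import Summits.Ventures.YMGap.RobustBall.FreeEnergyLawDerivative
import Summits.Ventures.YMGap.RobustBall.FreeEnergyDifferentiable
import Summits.Ventures.YMGap.Thresholds.PressureDerivative
import HarnessLib

/-!
# Robust ball (Y2), area-law side — THE INTERNAL-ENERGY LAW WITHOUT A DIFFERENTIABILITY HYPOTHESIS: every small coupling (Osterwalder–Seiler)
# and every coupling of the `SU(2)` one-state window (C-PRESS)

HONEST FRAMING: venture file of the cell `pub-ymgap` (QuantumFields programme), track ROBUST-BALL, seat rb-p2 (g7).  Two corollaries of rb-p2 g7's
internal-energy law `FreeEnergyLaw.deriv_freeEnergyDensity_two_sided` (which takes differentiability of the free energy density as a hypothesis):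
* ★★ `exists_forall_deriv_freeEnergyDensity_two_sided` — every `G ≅ SU(N)`, `N ≥ 2`, `d ≥ 2`: `∃ β₁ > 0 ∀ 0 ≤ s ≤ β₁`, `f` is differentiable at `s`
  (`FreeEnergyDifferentiable.exists_forall_differentiableAt_freeEnergyDensity`, Osterwalder–Seiler, no exceptional set) and
  `#planes · V₀ s e^{−2(d−1)(2d+1)Ns} ≤ f'(s) + #planes·N ≤ #planes · V₀ s e^{8(d−1)²Ns}`;
* ★★ `su2_deriv_freeEnergy_two_sided_window` — `SU(2)`, `d = 4`, EVERY `0 < β_W < 9/25`: `3β_W e^{−54β_W} ≤ f'(β_W/2) + 12 ≤ 3β_W e^{72β_W}`,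
  differentiability from seat ds-1 g9's C-PRESS regularity `PressureRegularity.su2_differentiableOn_freeEnergyDensity` (the energy–pressure chord);
  i.e. the thermodynamic mean plaquette `lim_L ⟨(1/2) Re tr U_p⟩_{Λ_L} = (f'(β_W/2) + 12)/12 = (β_W/4)·e^{[−54β_W, 72β_W]}` at every coupling of the window.
LATTICE, Wilson action; `β₁` existential; nothing continuum / spectral / Clay.  0 compute.  Everything here is proved. [folklore]
-/

noncomputable section

open MeasureTheory Filter Topology Finset
open Literature.MathematicalPhysics.QuantumLattice
open Literature.MathematicalPhysics.QuantumFieldTheory hiding ZdEdge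

namespace Summit.Ventures.YMGap.RobustBall

namespace FreeEnergyLaw

/-! ### The internal-energy law at every small coupling (Osterwalder–Seiler differentiability) -/

section Analytic

variable {d N : ℕ} {G : Type*} [Group G] [TopologicalSpace G] [IsTopologicalGroup G]
  [CompactSpace G] [MeasurableSpace G] [BorelSpace G] [SecondCountableTopology G] [T2Space G]
  (ρ : G →* Matrix (Fin N) (Fin N) ℂ)

/-- ★★ **THE INTERNAL-ENERGY LAW AT EVERY SMALL COUPLING** (`G ≅ SU(N)`, `N ≥ 2`, `d ≥ 2`): there is `β₁ > 0` such that for EVERY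
`0 ≤ s ≤ β₁` the free energy density is differentiable at `s` and
`#planes · V₀ s e^{−2(d−1)(2d+1)Ns} ≤ f'(s) + #planes·N ≤ #planes · V₀ s e^{8(d−1)²Ns}`. [folklore] -/
theorem exists_forall_deriv_freeEnergyDensity_two_sided (hρ : IsSpecialUnitaryModel ρ) (hN : 2 ≤ N) (hd : 2 ≤ d) :
    ∃ β₁ : ℝ, 0 < β₁ ∧ ∀ s : ℝ, 0 ≤ s → s ≤ β₁ →
      DifferentiableAt ℝ (freeEnergyDensity d ρ) s ∧
      (Fintype.card {q : Fin d × Fin d // q.1 < q.2} : ℝ) *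
          (PlaquetteLowerBound.charVariance ρ * s * Real.exp (-(2 * ((d : ℝ) - 1) * (2 * (d : ℝ) + 1) * N * s))) ≤
        deriv (freeEnergyDensity d ρ) s + (Fintype.card {q : Fin d × Fin d // q.1 < q.2} : ℝ) * N ∧
      deriv (freeEnergyDensity d ρ) s + (Fintype.card {q : Fin d × Fin d // q.1 < q.2} : ℝ) * N ≤
        (Fintype.card {q : Fin d × Fin d // q.1 < q.2} : ℝ) *
          (PlaquetteLowerBound.charVariance ρ * s * Real.exp (8 * ((d : ℝ) - 1) ^ 2 * N * s)) := by
  obtain ⟨β₁, hβ₁, h⟩ := exists_forall_differentiableAt_freeEnergyDensity (d := d) ρ hρ.1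
  refine ⟨β₁, hβ₁, fun s hs0 hs1 => ?_⟩
  have hdiff := h s (by rw [abs_of_nonneg hs0]; exact hs1)
  exact ⟨hdiff, deriv_freeEnergyDensity_two_sided (d := d) ρ hρ hN hd hs0 hdiff⟩

end Analytic


section Window

/-- ★★ **SU(2), `d = 4`: THE INTERNAL-ENERGY LAW AT EVERY COUPLING OF THE ONE-STATE WINDOW `0 < β_W < 9/25`** — there the free
energy density IS differentiable (seat ds-1 g9, `PressureRegularity.su2_differentiableOn_freeEnergyDensity`, C-PRESS: `f ∈ C¹` on the
window via the energy–pressure chord), so unconditionally `3β_W e^{−54β_W} ≤ f'(β_W/2) + 12 ≤ 3β_W e^{72β_W}`: the thermodynamic mean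
plaquette `lim_L ⟨(1/2) Re tr U_p⟩_{Λ_L} = (f'(β_W/2) + 12)/12 = (β_W/4)·e^{[−54β_W, 72β_W]}` at EVERY coupling of the window. [folklore] -/
theorem su2_deriv_freeEnergy_two_sided_window {βW : ℝ} (h0 : 0 < βW) (h1 : βW < 9 / 25) :
    3 * βW * Real.exp (-(54 * βW)) ≤ deriv (freeEnergyDensity 4 (fundamentalRep (Fin 2))) (βW / 2) + 12 ∧
      deriv (freeEnergyDensity 4 (fundamentalRep (Fin 2))) (βW / 2) + 12 ≤ 3 * βW * Real.exp (72 * βW) := by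
  have hmem : βW / 2 ∈ Set.Ioo (0 : ℝ) (9 / 50) := ⟨by linarith, by linarith⟩
  have hdiff : DifferentiableAt ℝ (freeEnergyDensity 4 (fundamentalRep (Fin 2))) (βW / 2) :=
    (PressureRegularity.su2_differentiableOn_freeEnergyDensity (βW / 2) hmem).differentiableAt (Ioo_mem_nhds hmem.1 hmem.2)
  exact su2_deriv_freeEnergy_two_sided_dim4 h0.le hdiff


end Window

end FreeEnergyLaw

end Summit.Ventures.YMGap.RobustBall
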